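import Summits.Ventures.GridStability.Bench.NE39SPSlabCSparse
import Summits.Ventures.GridStability.Lyapunov.NE39SPSlabSData

/-!
# GridStability/Bench/NE39SPSlabSDefs — rider «#53′ REGION»: the `P`-dependent ℚ blocks of `−slabMatrix` (dense definitions and
# sparse evaluation) for sos-4's level-optimised object

Cell `gridfusion` (LADDER-GRIDFUSION), SP–Lur'e lane, RIDER «#53′ REGION» of row #53 «G2.b-NE39SP-SLAB-CLQ» (lead RULING #53 OBJECT
08:38:22Z: after the row's MAIN; «Data swap + the same PSD/Bench structure»); seat gridfusion-model-2 (g6). OBJECT `NE39SP.relLurie D`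
(p494720), D = `1/10` uniform SYNTHETIC (R-SPCERT token); CERTIFICATE = sos-4's LEVEL-optimised structured-P («nbr») slab certificate
cert/sos-4/j273316/lchord-R6-NE39SP-D1o10-nbr-csJ-epsP-dm1e-05.json 033ca4741cd2bb31 / hand-over 621c7496cc97a527 (slab `u = 1/4`,
`γ_lo = 97/200`, `a = 5/8`, `b = 1`, `η = 1/1000`, `ε_P = 4131101/2²⁸`; ε-level `c = 38869529309/21474836480000`, inner ball ≈ 0.22°,
23× the row's), data `Lyapunov/NE39SPSlabSData` (sos-4 p517038; model-2's exact re-match kit j273712: −slabMatrix and P − ε1 of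
relLurie(1/10) equal entry by entry, json models/NE39SP-slabC6-rider-instance.json eef586a7a52d339b). Object-independent parts
(`D`, `e1`, `e2`, `AQ`/`BQ`/`CQ` + cast lemmas, the sparse lists of A, B, C and their decided lookups, the contraction lemmas) are
IMPORTED from `Bench/NE39SPSlabCDefs` / `Bench/NE39SPSlabCSparse`; only the `P`-dependent declarations are re-made here.
LABEL: pipeline object on a structure-preserving NE39 VARIANT with DECLARED SYNTHETIC DAMPING — not a sentence about the printed
New England system (MODEL-VALIDITY v0.33 R-SPCERT, v0.38 (c)).
-/

noncomputable section

open Matrix Literature.Computation.Certificates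
open Summit.Ventures.GridStability.Models Summit.Ventures.GridStability.Models.NE39SP
open Summit.Ventures.GridStability.Lyapunov.NE39SPSlabS
open Summit.Ventures.GridStability.Bench.NE39SPSlabC (e1 e2 AQ BQ CQ lsum sum_lsum_mul sum_mul_lsum colsA colsB rowsC colsC hAc hAcT hBc hCr hCc hCcT)

namespace Summit.Ventures.GridStability.Bench.NE39SPSlabS

/-- `P` over `ℚ`, reindexed to the state type (rider object). -/
def PQB : Matrix (Fin 48 ⊕ Fin 10) (Fin 48 ⊕ Fin 10) ℚ := PSq.submatrix e1 e1

/-- `τ_e·a·b` (`a = 5/8`, `b = 1`). -/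
def tabQ : Fin 56 → ℚ := fun e => tauSQ e * (aSQ * 1)

/-- `τ_e·(a + b)/2`. -/
def tab2Q : Fin 56 → ℚ := fun e => tauSQ e * (aSQ + 1) / 2

/-- state block over `ℚ` (dense definition). -/
def L11Q : Matrix (Fin 48 ⊕ Fin 10) (Fin 48 ⊕ Fin 10) ℚ :=
  AQᵀ * PQB + PQB * AQ + etaSQ • (1 : Matrix (Fin 48 ⊕ Fin 10) (Fin 48 ⊕ Fin 10) ℚ)
    - CQᵀ * Matrix.diagonal tabQ * CQ

/-- cross block over `ℚ` (dense definition). -/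
def L12Q : Matrix (Fin 48 ⊕ Fin 10) (Fin 56) ℚ :=
  -(PQB * BQ) + (CQ * AQ)ᵀ * Matrix.diagonal lamSQ + CQᵀ * Matrix.diagonal tab2Q

/-- channel block over `ℚ` (dense definition). -/
def L22Q : Matrix (Fin 56) (Fin 56) ℚ :=
  -(Matrix.diagonal lamSQ * (CQ * BQ)) - (Matrix.diagonal lamSQ * (CQ * BQ))ᵀ - Matrix.diagonal tauSQ

/-- `−𝓛` over `ℚ` on the sum index type (dense definition). -/
def negLQ : Matrix ((Fin 48 ⊕ Fin 10) ⊕ Fin 56) ((Fin 48 ⊕ Fin 10) ⊕ Fin 56) ℚ :=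
  -(Matrix.fromBlocks L11Q L12Q L12Qᵀ L22Q)

/-! ### Sparse evaluation (lists and lookups from `Bench/NE39SPSlabCSparse`) -/

/-- `(AᵀP)_ij`. -/
def AtP (i j : Fin 48 ⊕ Fin 10) : ℚ := ((colsA i).map fun ka => ka.2 * PQB ka.1 j).sum
/-- `(PA)_ij`. -/
def PA (i j : Fin 48 ⊕ Fin 10) : ℚ := ((colsA j).map fun ka => PQB i ka.1 * ka.2).sum
/-- `(Cᵀ·diag(τab)·C)_ij`. -/
def CtTC (i j : Fin 48 ⊕ Fin 10) : ℚ := ((colsC i).map fun ec => ec.2 * (tabQ ec.1 * lsum (rowsC ec.1) j)).sum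
/-- `(PB)_ie`. -/
def PB (i : Fin 48 ⊕ Fin 10) (e : Fin 56) : ℚ := ((colsB e).map fun kb => PQB i kb.1 * kb.2).sum
/-- `(CA)_ej`. -/
def CA (e : Fin 56) (j : Fin 48 ⊕ Fin 10) : ℚ := ((rowsC e).map fun kc => kc.2 * lsum (colsA j) kc.1).sum
/-- `(CB)_ef`. -/
def CB (e f : Fin 56) : ℚ := ((rowsC e).map fun kc => kc.2 * lsum (colsB f) kc.1).sum

/-- `AᵀP` sparsely. -/
theorem AtP_eq : AQᵀ * PQB = Matrix.of AtP := by
  ext i j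
  rw [Matrix.mul_apply, Matrix.of_apply, AtP]
  simp only [hAcT]
  exact sum_lsum_mul _ _
/-- `PA` sparsely. -/
theorem PA_eq : PQB * AQ = Matrix.of PA := by
  ext i j
  rw [Matrix.mul_apply, Matrix.of_apply, PA]
  simp only [hAc]
  exact sum_mul_lsum _ _
/-- `Cᵀ·diag·C` sparsely. -/
theorem CtTC_eq : CQᵀ * Matrix.diagonal tabQ * CQ = Matrix.of CtTC := by
  rw [Matrix.mul_assoc]
  ext i j
  rw [Matrix.mul_apply, Matrix.of_apply, CtTC]
  simp only [hCcT, Matrix.diagonal_mul, hCr]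
  exact sum_lsum_mul _ _
/-- `PB` sparsely. -/
theorem PB_eq : PQB * BQ = Matrix.of PB := by
  ext i e
  rw [Matrix.mul_apply, Matrix.of_apply, PB]
  simp only [hBc]
  exact sum_mul_lsum _ _
/-- `CA` sparsely. -/
theorem CA_eq : CQ * AQ = Matrix.of CA := by
  ext e j
  rw [Matrix.mul_apply, Matrix.of_apply, CA]
  simp only [hCr, hAc]
  exact sum_lsum_mul _ _
/-- `CB` sparsely. -/
theorem CB_eq : CQ * BQ = Matrix.of CB := by
  ext e f
  rw [Matrix.mul_apply, Matrix.of_apply, CB]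
  simp only [hCr, hBc]
  exact sum_lsum_mul _ _

/-- state block, sparse form. -/
def L11S : Matrix (Fin 48 ⊕ Fin 10) (Fin 48 ⊕ Fin 10) ℚ :=
  Matrix.of fun i j => AtP i j + PA i j + (if i = j then etaSQ else 0) - CtTC i j
/-- cross block, sparse form. -/
def L12S : Matrix (Fin 48 ⊕ Fin 10) (Fin 56) ℚ :=
  Matrix.of fun i e => -PB i e + CA e i * lamSQ e + lsum (colsC i) e * tab2Q e
/-- channel block, sparse form. -/
def L22S : Matrix (Fin 56) (Fin 56) ℚ :=
  Matrix.of fun e f => -(lamSQ e * CB e f) - lamSQ f * CB f e - (if e = f then tauSQ e else 0)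

/-- `L11Q = L11S`. -/
theorem L11_eqS : L11Q = L11S := by
  rw [L11Q, AtP_eq, PA_eq, CtTC_eq]
  ext i j
  simp only [L11S, Matrix.of_apply, Matrix.add_apply, Matrix.sub_apply, Matrix.smul_apply, Matrix.one_apply,
    smul_eq_mul, mul_ite, mul_one, mul_zero]
/-- `L12Q = L12S`. -/
theorem L12_eqS : L12Q = L12S := by
  rw [L12Q, PB_eq, CA_eq]
  ext i e
  simp only [L12S, Matrix.of_apply, Matrix.add_apply, Matrix.neg_apply, Matrix.mul_diagonal,
    Matrix.transpose_apply, hCc]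
/-- `L22Q = L22S`. -/
theorem L22_eqS : L22Q = L22S := by
  rw [L22Q, CB_eq]
  ext e f
  simp only [L22S, Matrix.of_apply, Matrix.sub_apply, Matrix.neg_apply, Matrix.diagonal_mul,
    Matrix.transpose_apply, Matrix.diagonal_apply]

/-- `−𝓛`, sparse form. -/
def negLS : Matrix ((Fin 48 ⊕ Fin 10) ⊕ Fin 56) ((Fin 48 ⊕ Fin 10) ⊕ Fin 56) ℚ :=
  -(Matrix.fromBlocks L11S L12S L12Sᵀ L22S)

/-- **`negLQ = negLS`**. -/
theorem negLQ_eq_negLS : negLQ = negLS := by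
  rw [negLQ, negLS, L11_eqS, L12_eqS, L22_eqS]

/-- the flattened identity row, sparse form (decided block by block in `Bench/NE39SPSlabSIdS*`). -/
def IdRowS (p : Fin 114) : Prop := ∀ q : Fin 114, negLS (e2.symm p) (e2.symm q) = AqS p q

/-- `IdRowS p` is decidable (a finite conjunction of rational equalities). -/
instance (p : Fin 114) : Decidable (IdRowS p) := by unfold IdRowS; infer_instance

end Summit.Ventures.GridStability.Bench.NE39SPSlabS

end
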